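import Literature.AlgebraicGeometry.Resolution.NeronPopescuLiftingProblem
import Literature.AlgebraicGeometry.Resolution.NeronPopescuLocalTricks
import Literature.AlgebraicGeometry.Resolution.NeronPopescuFlatSeparable
import Mathlib.RingTheory.MvPolynomial.Ideal
import Mathlib.RingTheory.Localization.Ideal
import Mathlib.RingTheory.KrullDimension.Zero
import Literature.AlgebraicGeometry.Resolution.NeronPopescuSteps
import Mathlib.RingTheory.Smooth.Field
import Mathlib.RingTheory.Smooth.StandardSmoothOfFree
import HarnessLib

/-!
# The Artinian step of Stacks 07FE: Algebra 07BV in standard smooth form, and 07BV + 07CM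

Topic: `Literature/AlgebraicGeometry/Resolution`. Support file of the INLINE proof of the named
fact `Stacks07FE_resolveSpecial` (`NeronPopescuSteps.lean`). The printed proof of 07FE ends:
"Hence `R_𝔭/(x_1^e, …, x_d^e) → Λ_𝔮/(π_1^e, …, π_d^e)` is a flat map of Artinian local rings.
Moreover, this map induces a separable field extension on residue fields by assumption. Thus
this map is a filtered colimit of smooth algebras by Algebra, Lemma 07BV and Proposition 07CM.
Existence of the desired solution follows from Algebra, Lemma 07C3." With Proposition 07CM
proved in `NeronPopescuLiftingProblem.lean` (in the factorisation form of 07C3 through standard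
smooth algebras, `HasStandardSmoothFactorizations`), this file PROVES that step as one abstract
statement:

* `hasStandardSmoothFactorizations_of_isSeparableFieldExtension` — **Algebra, Lemma 07BV**
  (with 037X, 07ND, 07CI) in standard smooth factorisation form: for `K/k` separable
  (Def. 030O, `IsSeparableFieldExtension`) every finitely presented `k`-algebra map `A → K`
  factors through a STANDARD smooth `k`-algebra (`k[t]_g` for the image `k[t]`, by Mathlib's
  `Algebra.IsSmoothAt.exists_notMem_isStandardSmooth`; cf. the smooth form
  `factorsThroughSmooth_of_isSeparableFieldExtension` in `NeronPopescuFlatSeparable.lean`).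
* `hasStandardSmoothFactorizations_of_flat_of_separable_residueField` — **the Artinian step**:
  `R'` a `k`-algebra with a nilpotent ideal `𝔪` and `k → R'/𝔪` bijective, `Λ'` a flat
  `R'`-algebra with a `k`-surjection `ρ : Λ' → K` onto a field separable over `k` with kernel
  `𝔪Λ'`; then every finitely presented `R'`-algebra map `A → Λ'` factors through a standard
  smooth `R'`-algebra (07BV over `k`, transported to `R'/𝔪 ≅ k` and `Λ'/𝔪Λ' ≅ K`, then 07CM).
  In 07FE: `R' = R_𝔭/(x^e)` (`k = R'/𝔪'`), `Λ' = Λ_𝔮/(π^e)`, `K = κ(𝔮)`, flatness by Algebra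
  07DY (`NeronPopescuFlatSeparable.lean`).
* `canResolve_of_flat_of_separable_residueField` — **the endgame of 07FE assembled** with
  Lemmas 07F9 + 07FA (`NeronPopescuLocalTricks.lean`): under the above hypotheses on
  `R' → Λ_𝔮 → K` (and `𝔥_A ⊆ 𝔮`, `dim Λ_𝔮 = 0`), `R' → A → Λ ⊃ 𝔮` can be resolved
  (`CanResolve`).
* `Stacks07FE_endgame` — **the same in the coordinates of the proof of 07FE**: `k` a field, `Λ`
  a Noetherian `k`-algebra, `𝔮` prime with `Λ_𝔮` regular of dimension `d` and `κ(𝔮)/k`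
  separable, `R = k[x_1, …, x_d] → Λ` with `x_i ↦ π_i` generating `𝔮Λ_𝔮` (07FD (1)), and an
  ideal `(x)^M ⊆ I ⊆ (x)` of `R` (in 07FE: `I = (x_1^e, …, x_d^e)`): every
  `R/I → A → Λ/IΛ ⊃ 𝔮/IΛ` with `A` finitely presented and `𝔥_A ⊆ 𝔮/IΛ` can be resolved. This
  packages Algebra 07DY (flatness of `R_{(x)} → Λ_𝔮`, `NeronPopescuFlatSeparable.lean`), the base
  change to `R/I`, the identification `(Λ/IΛ)_{𝔮/IΛ} = Λ_𝔮/IΛ_𝔮` (Artinian local, residue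
  field `κ(𝔮)` over `k = R/(x)`), 07BV + 07CM and 07F9 + 07FA. What is left of the printed
  proof of 07FE before this point: the construction of `B`, `C` (07CE, 07EZ), the choice of
  `π` (07FD, `NeronPopescuOgoma.lean`) and Lemma 07F8.

## Sources

* The Stacks Project, *Smoothing Ring Maps* (Tag 07BW), proof of Lemma 07FE (last paragraph);
  *Algebra*: Lemma 07BV (10.158.11), 037X, 07ND, 07C3; Smoothing Ring Maps 07CI, 07CM.
  [StacksProject]
-/

noncomputable section

namespace Literature.AlgebraicGeometry.Resolution

universe u v

open MvPolynomial TensorProduct IsLocalRing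

/-! ## The Artinian step of Stacks 07FE: 07BV (standard smooth form) + 07CM -/

section ArtinianStep

open scoped IntermediateField.algebraAdjoinAdjoin

/-- **Stacks, Algebra, Lemma 07BV with 07CI** (standard smooth form): if `K/k` is separable
(Def. 030O) then every `k`-algebra map `A → K` with `A` finitely presented factors through a
STANDARD smooth `k`-algebra: as in `factorsThroughSmooth_of_isSeparableFieldExtension`
(`NeronPopescuFlatSeparable.lean`), the image `k[t]` is smooth at `(0)`, and Mathlib's
`Algebra.IsSmoothAt.exists_notMem_isStandardSmooth` makes `k[t]_g` standard smooth.
[cite: StacksProject, Tag 07BV] -/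
theorem hasStandardSmoothFactorizations_of_isSeparableFieldExtension {k K : Type u} [Field k]
    [Field K] [Algebra k K] (hK : IsSeparableFieldExtension k K) :
    HasStandardSmoothFactorizations k K := by
  classical
  intro A _ _ hA φ
  haveI := hA
  obtain ⟨t, ht⟩ : φ.range.FG := by
    rw [← Algebra.map_top]
    exact Subalgebra.FG.map _ Algebra.FiniteType.out
  set S : Subalgebra k K := Algebra.adjoin k (t : Set K) with hS_def
  set L : IntermediateField k K := IntermediateField.adjoin k (t : Set K) with hL_def
  haveI : Algebra.FiniteType k S := .adjoin_of_finite t.finite_toSet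
  haveI : Algebra.FinitePresentation k S :=
    (Algebra.FinitePresentation.of_finiteType (R := k) (A := S)).mp inferInstance
  obtain ⟨s, hs, hsep⟩ := hK L (IntermediateField.fg_adjoin_finset t)
  haveI : Algebra.FormallySmooth k L := by
    have : Algebra.IsSeparable (IntermediateField.adjoin k (Set.range ((↑) : s → L))) L := by
      convert! hsep <;> simp
    exact .of_algebraicIndependent_of_isSeparable hs.1
  haveI hfrac : IsFractionRing S (Localization.AtPrime (⊥ : Ideal S)) := by
    simpa [Ideal.primeCompl_bot] using
      Localization.isLocalization (M := (⊥ : Ideal S).primeCompl)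
  let e : Localization.AtPrime (⊥ : Ideal S) ≃ₐ[S] L :=
    IsLocalization.algEquiv (nonZeroDivisors S) _ _
  haveI : Algebra.IsSmoothAt k (⊥ : Ideal S) :=
    Algebra.FormallySmooth.of_equiv (e.restrictScalars k).symm
  obtain ⟨g, hg0, hsmooth⟩ := Algebra.IsSmoothAt.exists_notMem_isStandardSmooth k (⊥ : Ideal S)
  have hg : (g : K) ≠ 0 := fun h => hg0 (by
    rw [Ideal.mem_bot]
    exact_mod_cast h)
  have hunit : ∀ y : Submonoid.powers g, IsUnit (S.val y) := by
    rintro ⟨y, n, rfl⟩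
    exact isUnit_iff_ne_zero.mpr (by simpa using pow_ne_zero n hg)
  let w : Localization.Away g →ₐ[k] K := IsLocalization.liftAlgHom hunit
  have hφS : ∀ a, φ a ∈ S := fun a => by
    have ha : φ a ∈ φ.range := φ.mem_range_self a
    rwa [← ht] at ha
  let v : A →ₐ[k] Localization.Away g :=
    (IsScalarTower.toAlgHom k S (Localization.Away g)).comp (φ.codRestrict S hφS)
  refine ⟨Localization.Away g, inferInstance, inferInstance, hsmooth, v, w, ?_⟩
  ext a
  change w (algebraMap S (Localization.Away g) (φ.codRestrict S hφS a)) = φ a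
  rw [IsLocalization.coe_liftAlgHom, IsLocalization.lift_eq]
  rfl

/-- **The Artinian step of the proof of Stacks 07FE** ("`R_𝔭/(x^e) → Λ_𝔮/(π^e)` is a flat map
of Artinian local rings; the residue field extension is separable, so this map is a filtered
colimit of smooth algebras by Algebra, Lemma 07BV and Proposition 07CM"), as an abstract
statement: let `R'` be a `k`-algebra with a nilpotent ideal `𝔪` such that `k → R'/𝔪` is
bijective, `Λ'` a flat `R'`-algebra and `ρ : Λ' → K` a surjection of `k`-algebras onto a field
`K` separable over `k` with kernel `𝔪Λ'`. Then every finitely presented `R'`-algebra map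
`A → Λ'` factors through a standard smooth `R'`-algebra. [cite: StacksProject, Tag 07FE (proof)] -/
theorem hasStandardSmoothFactorizations_of_flat_of_separable_residueField
    {k : Type u} [Field k] {K : Type u} [Field K] [Algebra k K] (hK : IsSeparableFieldExtension k K)
    {R' : Type u} [CommRing R'] [Algebra k R'] (𝔪 : Ideal R') (h𝔪 : IsNilpotent 𝔪)
    (hk𝔪 : Function.Bijective ((Ideal.Quotient.mk 𝔪).comp (algebraMap k R')))
    {Λ' : Type v} [CommRing Λ'] [Algebra R' Λ'] [Algebra k Λ'] [IsScalarTower k R' Λ']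
    [Module.Flat R' Λ'] (ρ : Λ' →ₐ[k] K) (hρ : Function.Surjective ρ)
    (hker : RingHom.ker ρ = 𝔪.map (algebraMap R' Λ')) :
    HasStandardSmoothFactorizations R' Λ' := by
  classical
  -- `k ≅ k₁ = R'/𝔪` and `K₁ = Λ'/𝔪Λ' ≅ K`
  have halgk : algebraMap k (R' ⧸ 𝔪) = (Ideal.Quotient.mk 𝔪).comp (algebraMap k R') := rfl
  have hbij : Function.Bijective (algebraMap k (R' ⧸ 𝔪)) := by rw [halgk]; exact hk𝔪
  let ek : k ≃ₐ[k] R' ⧸ 𝔪 := AlgEquiv.ofBijective (Algebra.ofId k (R' ⧸ 𝔪)) hbij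
  have hek : ∀ x, ek x = algebraMap k (R' ⧸ 𝔪) x := fun x => rfl
  let eK : (Λ' ⧸ 𝔪.map (algebraMap R' Λ')) ≃ₐ[k] K :=
    (Ideal.quotientEquivAlgOfEq k hker.symm).trans (Ideal.quotientKerAlgEquivOfSurjective hρ)
  haveI : IsScalarTower k (R' ⧸ 𝔪) (Λ' ⧸ 𝔪.map (algebraMap R' Λ')) :=
    IsScalarTower.of_algebraMap_eq fun x => by
      rw [halgk, RingHom.comp_apply, Ideal.Quotient.algebraMap_quotient_map_quotient,
        ← IsScalarTower.algebraMap_apply, IsScalarTower.algebraMap_apply k Λ' (Λ' ⧸ _),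
        Ideal.Quotient.algebraMap_eq]
  -- standard smooth factorisations over `R'/𝔪`, transported from `k`
  have h₀ : HasStandardSmoothFactorizations (R' ⧸ 𝔪) (Λ' ⧸ 𝔪.map (algebraMap R' Λ')) := by
    intro A₀ _ _ hA₀ φ₀
    haveI := hA₀
    letI : Algebra k A₀ := ((algebraMap (R' ⧸ 𝔪) A₀).comp (algebraMap k (R' ⧸ 𝔪))).toAlgebra
    haveI : IsScalarTower k (R' ⧸ 𝔪) A₀ := IsScalarTower.of_algebraMap_eq fun _ => rfl
    haveI : Algebra.FinitePresentation k (R' ⧸ 𝔪) := Algebra.FinitePresentation.equiv ek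
    haveI : Algebra.FinitePresentation k A₀ := Algebra.FinitePresentation.trans k (R' ⧸ 𝔪) A₀
    let φ₀' : A₀ →ₐ[k] K := (eK : _ →ₐ[k] K).comp (φ₀.restrictScalars k)
    obtain ⟨S, _, _, hS, α, β, hβα⟩ :=
      hasStandardSmoothFactorizations_of_isSeparableFieldExtension hK A₀ inferInstance φ₀'
    have hβα' : ∀ a, β (α a) = eK (φ₀ a) := fun a => AlgHom.congr_fun hβα a
    -- `S` as an `R'/𝔪`-algebra
    letI : Algebra (R' ⧸ 𝔪) S := ((algebraMap k S).comp (ek.symm : R' ⧸ 𝔪 →+* k)).toAlgebra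
    have halgS : ∀ y, algebraMap (R' ⧸ 𝔪) S y = algebraMap k S (ek.symm y) := fun y => rfl
    haveI : IsScalarTower k (R' ⧸ 𝔪) S := IsScalarTower.of_algebraMap_eq fun x => by
      rw [halgS, ← hek, AlgEquiv.symm_apply_apply]
    letI : Algebra (R' ⧸ 𝔪) k := (ek.symm : R' ⧸ 𝔪 →+* k).toAlgebra
    have halgk' : ∀ y, algebraMap (R' ⧸ 𝔪) k y = ek.symm y := fun y => rfl
    haveI : IsScalarTower (R' ⧸ 𝔪) k S := IsScalarTower.of_algebraMap_eq fun y => by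
      rw [halgS, halgk']
    haveI : Algebra.IsStandardSmooth (R' ⧸ 𝔪) k :=
      (Algebra.IsStandardSmoothOfRelativeDimension.of_algebraMap_bijective
        (show Function.Bijective (algebraMap (R' ⧸ 𝔪) k) from ek.symm.bijective)).isStandardSmooth
    haveI := hS
    have hSS : Algebra.IsStandardSmooth (R' ⧸ 𝔪) S := Algebra.IsStandardSmooth.trans (R' ⧸ 𝔪) k S
    -- the maps, over `R'/𝔪`
    have hsurjk : ∀ y : R' ⧸ 𝔪, ∃ x : k, ek x = y := ek.surjective
    let α₁ : A₀ →ₐ[R' ⧸ 𝔪] S :=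
      { toRingHom := α.toRingHom
        commutes' := fun y => by
          obtain ⟨x, rfl⟩ := hsurjk y
          change α (algebraMap (R' ⧸ 𝔪) A₀ (ek x)) = algebraMap (R' ⧸ 𝔪) S (ek x)
          rw [hek, ← IsScalarTower.algebraMap_apply, ← IsScalarTower.algebraMap_apply,
            AlgHom.commutes] }
    let β₁ : S →ₐ[R' ⧸ 𝔪] Λ' ⧸ 𝔪.map (algebraMap R' Λ') :=
      { toRingHom := (eK.symm : K →ₐ[k] _).toRingHom.comp β.toRingHom
        commutes' := fun y => by
          obtain ⟨x, rfl⟩ := hsurjk y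
          change eK.symm (β (algebraMap (R' ⧸ 𝔪) S (ek x))) = algebraMap (R' ⧸ 𝔪) _ (ek x)
          rw [hek, ← IsScalarTower.algebraMap_apply, ← IsScalarTower.algebraMap_apply,
            AlgHom.commutes, AlgEquiv.commutes] }
    refine ⟨S, inferInstance, inferInstance, hSS, α₁, β₁, ?_⟩
    apply AlgHom.ext
    intro a
    change eK.symm (β (α a)) = φ₀ a
    rw [hβα', AlgEquiv.symm_apply_apply]
  exact Stacks07CM_hasStandardSmoothFactorizations 𝔪 h𝔪 h₀

end ArtinianStep

/-! ## The endgame of Stacks 07FE: Artinian step + local tricks -/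

section Endgame

/-- **The last step of the proof of Stacks, Lemma 07FE, assembled**: in the situation
`R' → A → Λ ⊃ 𝔮` with `R'` a Noetherian `k`-algebra carrying a nilpotent ideal `𝔪` with
`k → R'/𝔪` bijective (in 07FE: `R' = R/(x_1^e, …, x_d^e)`, `R = k[x_1, …, x_d]`, localized or
not), `A` finitely presented over `R'`, `𝔥_A ⊆ 𝔮`, `dim Λ_𝔮 = 0`, `Λ_𝔮` flat over `R'` (07DY)
with a `k`-surjection `Λ_𝔮 → K` of kernel `𝔪Λ_𝔮` onto a field `K` separable over `k` (the
residue field `κ(𝔮)`), the triple `R' → A → Λ ⊃ 𝔮` can be resolved: by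
`hasStandardSmoothFactorizations_of_flat_of_separable_residueField` (07BV + 07CM) the map
`A → Λ → Λ_𝔮` factors through a standard smooth `R'`-algebra, and Lemmas 07F9 + 07FA
(`canResolve_of_smooth_local_factorization_of_krullDimLE_zero`, `NeronPopescuLocalTricks.lean`)
conclude. [cite: StacksProject, Tag 07FE (proof)] -/
theorem canResolve_of_flat_of_separable_residueField
    {k : Type u} [Field k] {K : Type u} [Field K] [Algebra k K] (hK : IsSeparableFieldExtension k K)
    {R' : Type u} [CommRing R'] [IsNoetherianRing R'] [Algebra k R'] (𝔪 : Ideal R')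
    (h𝔪 : IsNilpotent 𝔪) (hk𝔪 : Function.Bijective ((Ideal.Quotient.mk 𝔪).comp (algebraMap k R')))
    {A : Type u} [CommRing A] [Algebra R' A] [Algebra.FinitePresentation R' A]
    {Λ : Type u} [CommRing Λ] [Algebra R' Λ] [Algebra k Λ] [IsScalarTower k R' Λ]
    (ψ : A →ₐ[R'] Λ) (q : Ideal Λ) [q.IsPrime] (hq : hIdeal R' ψ ≤ q)
    (hdim : Ring.KrullDimLE 0 (Localization.AtPrime q))
    [Module.Flat R' (Localization.AtPrime q)]
    (ρ : Localization.AtPrime q →ₐ[k] K) (hρ : Function.Surjective ρ)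
    (hker : RingHom.ker ρ = 𝔪.map (algebraMap R' (Localization.AtPrime q))) :
    CanResolve R' ψ q := by
  have hfact := hasStandardSmoothFactorizations_of_flat_of_separable_residueField hK 𝔪 h𝔪 hk𝔪
    (Λ' := Localization.AtPrime q) ρ hρ hker
  obtain ⟨C, _, _, hC, u, v, huv⟩ :=
    hfact A inferInstance ((IsScalarTower.toAlgHom R' Λ (Localization.AtPrime q)).comp ψ)
  haveI := hC
  exact canResolve_of_smooth_local_factorization_of_krullDimLE_zero ψ q hq hdim C u v
    (fun a => AlgHom.congr_fun huv a)

end Endgame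

/-! ## The endgame of 07FE in the coordinates of its proof -/

section ConcreteEndgame

open IsLocalRing

/-- **The last paragraph of the proof of Stacks, Lemma 07FE, in its own coordinates.** Let `k` be
a field, `Λ` a Noetherian `k`-algebra, `𝔮 ⊂ Λ` a prime with `Λ_𝔮` regular of dimension `d`
and `κ(𝔮)/k` separable, and let `R = k[x_1, …, x_d] → Λ` send the variables to
`π_1, …, π_d ∈ Λ` generating `𝔮Λ_𝔮` (Lemma 07FD (1)). For an ideal
`(x_1, …, x_d)^M ⊆ I ⊆ (x_1, …, x_d)` of `R` (in 07FE: `I = (x_1^e, …, x_d^e)`), every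
`R/I → A → Λ/IΛ ⊃ 𝔮/IΛ` with `A` finitely presented over `R/I` and `𝔥_A ⊆ 𝔮/IΛ` can be
resolved: "`R_𝔭/(x^e) → Λ_𝔮/(π^e)` is a flat map of Artinian local rings [Algebra 07DY:
`flat_of_ofList_eq_maximalIdeal_of_isWeaklyRegular`] … the residue field extension is
separable … this map is a filtered colimit of smooth algebras by Algebra, Lemma 07BV and
Proposition 07CM [`hasStandardSmoothFactorizations_of_flat_of_separable_residueField`] …
by Lemma 07FA it suffices to resolve after localizing at 𝔮
[`canResolve_of_smooth_local_factorization_of_krullDimLE_zero`]".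
[cite: StacksProject, Tag 07FE (proof)] -/
theorem Stacks07FE_endgame {k : Type u} [Field k] {Λ : Type u} [CommRing Λ] [Algebra k Λ]
    [IsNoetherianRing Λ] {d : ℕ} [Algebra (MvPolynomial (Fin d) k) Λ]
    [IsScalarTower k (MvPolynomial (Fin d) k) Λ] (q : Ideal Λ) [q.IsPrime]
    [IsRegularLocalRing (Localization.AtPrime q)] (hd : ringKrullDim (Localization.AtPrime q) = d)
    (hπ : Ideal.span (Set.range fun i => algebraMap Λ (Localization.AtPrime q)
      (algebraMap (MvPolynomial (Fin d) k) Λ (MvPolynomial.X i))) =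
        maximalIdeal (Localization.AtPrime q))
    (hsep : IsSeparableFieldExtension k q.ResidueField)
    (I : Ideal (MvPolynomial (Fin d) k)) (M : ℕ)
    (hI₁ : MvPolynomial.idealOfVars (Fin d) k ^ M ≤ I) (hI₂ : I ≤ MvPolynomial.idealOfVars (Fin d) k)
    (A : Type u) [CommRing A] [Algebra (MvPolynomial (Fin d) k ⧸ I) A]
    [Algebra.FinitePresentation (MvPolynomial (Fin d) k ⧸ I) A]
    (ψ : A →ₐ[MvPolynomial (Fin d) k ⧸ I]
      Λ ⧸ I.map (algebraMap (MvPolynomial (Fin d) k) Λ))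
    (hq : hIdeal (MvPolynomial (Fin d) k ⧸ I) ψ ≤
      q.map (Ideal.Quotient.mk (I.map (algebraMap (MvPolynomial (Fin d) k) Λ)))) :
    CanResolve (MvPolynomial (Fin d) k ⧸ I) ψ
      (q.map (Ideal.Quotient.mk (I.map (algebraMap (MvPolynomial (Fin d) k) Λ)))) := by
  classical
  -- notation
  set R := MvPolynomial (Fin d) k with hR
  set p : Ideal R := MvPolynomial.idealOfVars (Fin d) k with hp
  set Λq := Localization.AtPrime q with hΛq
  set IΛ : Ideal Λ := I.map (algebraMap R Λ) with hIΛ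
  set qb : Ideal (Λ ⧸ IΛ) := q.map (Ideal.Quotient.mk IΛ) with hqb
  let π : Fin d → Λ := fun i => algebraMap R Λ (MvPolynomial.X i)
  -- `π i ∈ 𝔮`, `pΛ ⊆ 𝔮`, `IΛ ⊆ 𝔮`
  have hπq : ∀ i, π i ∈ q := fun i => by
    rw [← IsLocalization.AtPrime.to_map_mem_maximal_iff Λq q, ← hπ]
    exact Ideal.subset_span ⟨i, rfl⟩
  have hpq : p.map (algebraMap R Λ) ≤ q := by
    rw [hp, MvPolynomial.idealOfVars, Ideal.map_span, Ideal.span_le]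
    rintro _ ⟨_, ⟨i, rfl⟩, rfl⟩
    exact hπq i
  have hIq : IΛ ≤ q := (Ideal.map_mono hI₂).trans hpq
  haveI hqb_prime : qb.IsPrime :=
    Ideal.map_isPrime_of_surjective Ideal.Quotient.mk_surjective (by rwa [Ideal.mk_ker])
  -- constants modulo `p`: `f ≡ C (coeff 0 f)`
  have hmodp : ∀ f : R, f - MvPolynomial.C (MvPolynomial.coeff 0 f) ∈ p := fun f => by
    rw [hp, ← pow_one (MvPolynomial.idealOfVars (Fin d) k), MvPolynomial.mem_pow_idealOfVars_iff']
    intro x hx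
    have hx0 : x = 0 := (Finsupp.degree_eq_zero_iff x).mp (Nat.lt_one_iff.mp hx)
    subst hx0
    rw [MvPolynomial.coeff_sub, MvPolynomial.coeff_zero_C, sub_self]
  have hCp : ∀ c : k, MvPolynomial.C c ∈ p → c = 0 := fun c hc => by
    rw [hp, ← pow_one (MvPolynomial.idealOfVars (Fin d) k), MvPolynomial.C_mem_pow_idealOfVars_iff] at hc
    exact hc.resolve_right one_ne_zero
  have hp_ne_top : p ≠ ⊤ := fun h => one_ne_zero (hCp 1 (by rw [MvPolynomial.C_1, h]; trivial))
  -- the nilpotent ideal `𝔪 = p/I` of `R/I`, with `R/I/𝔪 = k`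
  set 𝔪 : Ideal (R ⧸ I) := p.map (Ideal.Quotient.mk I) with h𝔪
  have h𝔪nil : IsNilpotent 𝔪 := by
    refine ⟨M, ?_⟩
    rw [h𝔪, ← Ideal.map_pow, Ideal.zero_eq_bot, eq_bot_iff, ← Ideal.map_quotient_self I]
    exact Ideal.map_mono hI₁
  have h𝔪_ne_top : 𝔪 ≠ ⊤ := by
    intro h
    have h1 : (1 : R ⧸ I) ∈ 𝔪 := h ▸ Submodule.mem_top
    rw [h𝔪, ← map_one (Ideal.Quotient.mk I), Ideal.mem_quotient_iff_mem_sup,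
      sup_eq_left.mpr hI₂] at h1
    exact hp_ne_top ((Ideal.eq_top_iff_one _).mpr h1)
  have hk𝔪 : Function.Bijective ((Ideal.Quotient.mk 𝔪).comp (algebraMap k (R ⧸ I))) := by
    haveI : Nontrivial ((R ⧸ I) ⧸ 𝔪) := Ideal.Quotient.nontrivial_iff.mpr h𝔪_ne_top
    refine ⟨RingHom.injective _, fun y => ?_⟩
    obtain ⟨y, rfl⟩ := Ideal.Quotient.mk_surjective y
    obtain ⟨f, rfl⟩ := Ideal.Quotient.mk_surjective y
    refine ⟨MvPolynomial.coeff 0 f, ?_⟩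
    rw [RingHom.comp_apply, Ideal.Quotient.eq, IsScalarTower.algebraMap_apply k R (R ⧸ I),
      Ideal.Quotient.algebraMap_eq, ← map_sub, h𝔪, MvPolynomial.algebraMap_eq]
    refine Ideal.mem_map_of_mem _ ?_
    have := p.neg_mem (hmodp f)
    rwa [neg_sub] at this
  ------------------------------------------------------------------
  -- flatness of `R → Λ_𝔮` (Algebra 07DY at `p = (x)`: `R_p → Λ_𝔮` is local, flat)
  ------------------------------------------------------------------
  -- `p` is maximal (`R/p = k`), in particular prime
  haveI hpmax : p.IsMaximal := by
    refine Ideal.Quotient.maximal_of_isField _ ⟨⟨0, 1, ?_⟩, mul_comm, fun {a} ha => ?_⟩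
    · intro h
      exact hp_ne_top ((Ideal.eq_top_iff_one _).mpr (by
        have := (Ideal.Quotient.eq (I := p)).mp h.symm
        simpa using this))
    · obtain ⟨f, rfl⟩ := Ideal.Quotient.mk_surjective a
      have hc : MvPolynomial.coeff 0 f ≠ 0 := by
        intro hc
        apply ha
        rw [Ideal.Quotient.eq_zero_iff_mem]
        have := hmodp f
        rwa [hc, MvPolynomial.C_0, sub_zero] at this
      refine ⟨Ideal.Quotient.mk p (MvPolynomial.C (MvPolynomial.coeff 0 f)⁻¹), ?_⟩
      rw [← map_mul, show f * MvPolynomial.C (MvPolynomial.coeff 0 f)⁻¹ =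
        1 + (f - MvPolynomial.C (MvPolynomial.coeff 0 f)) * MvPolynomial.C (MvPolynomial.coeff 0 f)⁻¹
        by rw [sub_mul, ← MvPolynomial.C_mul, mul_inv_cancel₀ hc, MvPolynomial.C_1]; ring,
        map_add, map_one, map_mul, Ideal.Quotient.eq_zero_iff_mem.mpr (hmodp f), zero_mul,
        add_zero]
  haveI : p.IsPrime := hpmax.isPrime
  set Rp := Localization.AtPrime p with hRp
  -- the maximal ideal of `Λ_𝔮` is `pΛ_𝔮`
  have hmaxq : maximalIdeal Λq = p.map (algebraMap R Λq) := by
    rw [← hπ, hp, MvPolynomial.idealOfVars, Ideal.map_span, ← Set.range_comp]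
    rfl
  -- `R → Λ_𝔮` inverts `R ∖ p`
  have hunits : ∀ s : p.primeCompl, IsUnit (algebraMap R Λq s) := by
    rintro ⟨s, hs⟩
    have hc : MvPolynomial.coeff 0 s ≠ 0 := by
      intro hc
      apply hs
      have := hmodp s
      rwa [hc, MvPolynomial.C_0, sub_zero] at this
    have hm : algebraMap R Λq (s - MvPolynomial.C (MvPolynomial.coeff 0 s)) ∈ maximalIdeal Λq := by
      rw [hmaxq]
      exact Ideal.mem_map_of_mem _ (hmodp s)
    have hu : IsUnit (algebraMap R Λq (MvPolynomial.C (MvPolynomial.coeff 0 s))) := by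
      rw [← MvPolynomial.algebraMap_eq, ← IsScalarTower.algebraMap_apply]
      exact (IsUnit.mk0 _ hc).map _
    by_contra hns
    have hmem : algebraMap R Λq s ∈ maximalIdeal Λq :=
      (IsLocalRing.mem_maximalIdeal _).mpr hns
    have : algebraMap R Λq (MvPolynomial.C (MvPolynomial.coeff 0 s)) ∈ maximalIdeal Λq := by
      have h := (maximalIdeal Λq).sub_mem hmem hm
      rwa [← map_sub, sub_sub_cancel] at h
    exact (IsLocalRing.mem_maximalIdeal _).mp this hu
  let fq : Rp →+* Λq := IsLocalization.lift hunits
  have hfq : ∀ x : R, fq (algebraMap R Rp x) = algebraMap R Λq x := fun x => IsLocalization.lift_eq hunits x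
  letI : Algebra Rp Λq := fq.toAlgebra
  have halgRp : algebraMap Rp Λq = fq := rfl
  haveI : IsScalarTower R Rp Λq := IsScalarTower.of_algebraMap_eq fun x => by
    rw [halgRp, hfq]
  haveI : IsLocalHom (algebraMap Rp Λq) := by
    refine ((IsLocalRing.local_hom_TFAE (algebraMap Rp Λq)).out 0 2).mpr ?_
    rw [← Localization.AtPrime.map_eq_maximalIdeal, Ideal.map_map, halgRp,
      IsLocalization.lift_comp, hmaxq]
  -- the images of the variables form a regular sequence in the regular local ring `Λ_𝔮`
  let xs : List Rp := List.ofFn fun i => algebraMap R Rp (MvPolynomial.X i)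
  have hxs_span : Ideal.ofList xs = maximalIdeal Rp := by
    rw [← Localization.AtPrime.map_eq_maximalIdeal,
      show Ideal.map (algebraMap R Rp) p =
        Ideal.map (algebraMap R Rp) (Ideal.span (Set.range MvPolynomial.X)) from rfl,
      Ideal.map_span, ← Set.range_comp, Ideal.ofList]
    congr 1
    ext a
    exact List.mem_ofFn' _ a
  have hxs_map : xs.map (algebraMap Rp Λq) = List.ofFn fun i => algebraMap Λ Λq (π i) := by
    rw [List.map_ofFn]
    congr 1
    funext i
    change fq (algebraMap R Rp (MvPolynomial.X i)) = _
    rw [hfq, IsScalarTower.algebraMap_apply R Λ Λq]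
  have hreg : RingTheory.Sequence.IsWeaklyRegular Λq (xs.map (algebraMap Rp Λq)) := by
    rw [hxs_map]
    refine (isRegular_of_span_eq_maximalIdeal Λq _ ?_ ?_).toIsWeaklyRegular
    · rw [← hπ, Ideal.ofList]
      congr 1
      ext a
      exact List.mem_ofFn' _ a
    · rw [List.length_ofFn, hd]
  haveI : Module.Flat Rp Λq :=
    flat_of_ofList_eq_maximalIdeal_of_isWeaklyRegular d xs (List.length_ofFn ..) hxs_span hreg
  haveI : Module.Flat R Rp := IsLocalization.flat Rp p.primeCompl
  haveI : Module.Flat R Λq := Module.Flat.trans R Rp Λq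
  ------------------------------------------------------------------
  -- `T = Λ_𝔮/IΛ_𝔮` is flat over `R/I`, local of dimension `0`, and is `(Λ/IΛ)_{𝔮/IΛ}`
  ------------------------------------------------------------------
  set J : Ideal Λq := I.map (algebraMap R Λq) with hJ
  haveI hflatT : Module.Flat (R ⧸ I) (Λq ⧸ J) := flat_quotient_map_of_flat I
  have hJle : J ≤ maximalIdeal Λq := by
    rw [hmaxq]
    exact Ideal.map_mono hI₂
  have hJ_ne_top : J ≠ ⊤ := ne_top_of_le_ne_top (maximalIdeal.isMaximal Λq).ne_top hJle
  haveI : Nontrivial (Λq ⧸ J) := Ideal.Quotient.nontrivial_iff.mpr hJ_ne_top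
  haveI : IsLocalRing (Λq ⧸ J) := isLocalRing_quotient hJ_ne_top
  have hmaxT : maximalIdeal (Λq ⧸ J) = (maximalIdeal Λq).map (Ideal.Quotient.mk J) :=
    maximalIdeal_quotient_eq_map J
  -- dimension zero: the maximal ideal of `T` is nilpotent
  have hdimT : Ring.KrullDimLE 0 (Λq ⧸ J) := by
    have h4 := (Ring.krullDimLE_zero_and_isLocalRing_tfae (R := Λq ⧸ J)).out 3 0
    refine (h4.mp ?_).1
    have hnil : maximalIdeal (Λq ⧸ J) ≤ nilradical (Λq ⧸ J) := by
      intro x hx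
      rw [hmaxT] at hx
      obtain ⟨y, hy, rfl⟩ := (Ideal.mem_map_iff_of_surjective _ Ideal.Quotient.mk_surjective).mp hx
      refine ⟨M, ?_⟩
      rw [← map_pow, Ideal.zero_eq_bot, Ideal.mem_bot, Ideal.Quotient.eq_zero_iff_mem, hJ]
      have : y ^ M ∈ (maximalIdeal Λq) ^ M := Ideal.pow_mem_pow hy M
      rw [hmaxq, ← Ideal.map_pow] at this
      exact Ideal.map_mono hI₁ this
    have heq : nilradical (Λq ⧸ J) = maximalIdeal (Λq ⧸ J) :=
      le_antisymm (nilradical_le_prime _) hnil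
    rw [heq]
    exact maximalIdeal.isMaximal _
  -- `T` as a `Λ/IΛ`-algebra, compatible with `R/I`
  have hIJ : IΛ ≤ J.comap (algebraMap Λ Λq) := by
    rw [hIΛ, Ideal.map_le_iff_le_comap, Ideal.comap_comap, ← IsScalarTower.algebraMap_eq]
    exact Ideal.le_comap_map
  letI : Algebra (Λ ⧸ IΛ) (Λq ⧸ J) := Ideal.Quotient.algebraQuotientOfLEComap hIJ
  have halgT : ∀ x, algebraMap (Λ ⧸ IΛ) (Λq ⧸ J) (Ideal.Quotient.mk IΛ x) =
      Ideal.Quotient.mk J (algebraMap Λ Λq x) := fun x => rfl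
  haveI : IsScalarTower (R ⧸ I) (Λ ⧸ IΛ) (Λq ⧸ J) :=
    IsScalarTower.of_algebraMap_eq fun x => by
      obtain ⟨r, rfl⟩ := Ideal.Quotient.mk_surjective x
      rw [Ideal.Quotient.algebraMap_quotient_map_quotient,
        Ideal.Quotient.algebraMap_quotient_map_quotient, halgT, IsScalarTower.algebraMap_apply R Λ Λq]
  haveI : IsScalarTower Λ (Λ ⧸ IΛ) (Λq ⧸ J) :=
    IsScalarTower.of_algebraMap_eq fun x => by
      rw [Ideal.Quotient.algebraMap_eq, halgT, IsScalarTower.algebraMap_apply Λ Λq (Λq ⧸ J),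
        Ideal.Quotient.algebraMap_eq]
  haveI : IsScalarTower R (Λ ⧸ IΛ) (Λq ⧸ J) :=
    IsScalarTower.of_algebraMap_eq fun r => by
      rw [IsScalarTower.algebraMap_apply R Λ (Λ ⧸ IΛ), Ideal.Quotient.algebraMap_eq, halgT,
        ← IsScalarTower.algebraMap_apply R Λ Λq, IsScalarTower.algebraMap_apply R Λq (Λq ⧸ J),
        Ideal.Quotient.algebraMap_eq]
  -- `T` is the localisation of `Λ/IΛ` at `𝔮/IΛ`
  have hker_mk : RingHom.ker (Ideal.Quotient.mk J) ≤
      (RingHom.ker (Ideal.Quotient.mk IΛ)).map (algebraMap Λ Λq) := by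
    rw [Ideal.mk_ker, Ideal.mk_ker, hJ, hIΛ, Ideal.map_map, ← IsScalarTower.algebraMap_eq]
  have hloc' : IsLocalization (q.primeCompl.map (Ideal.Quotient.mk IΛ)) (Λq ⧸ J) :=
    IsLocalization.of_surjective q.primeCompl Λq (Ideal.Quotient.mk IΛ)
      Ideal.Quotient.mk_surjective (Ideal.Quotient.mk J) Ideal.Quotient.mk_surjective rfl hker_mk
  have hsub : q.primeCompl.map (Ideal.Quotient.mk IΛ) = qb.primeCompl := by
    ext x
    constructor
    · rintro ⟨s, hs, rfl⟩ hx
      have h := Ideal.mem_quotient_iff_mem_sup.mp hx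
      rw [sup_eq_left.mpr hIq] at h
      exact hs h
    · intro hx
      obtain ⟨s, rfl⟩ := Ideal.Quotient.mk_surjective x
      exact ⟨s, fun hs => hx (Ideal.mem_map_of_mem _ hs), rfl⟩
  haveI hloc : IsLocalization qb.primeCompl (Λq ⧸ J) := by rw [← hsub]; exact hloc'
  let e : Localization.AtPrime qb ≃ₐ[Λ ⧸ IΛ] Λq ⧸ J :=
    IsLocalization.algEquiv qb.primeCompl _ _
  -- flatness and dimension of `(Λ/IΛ)_{𝔮/IΛ}`
  haveI : Module.Flat (R ⧸ I) (Localization.AtPrime qb) :=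
    Module.Flat.of_linearEquiv (e.restrictScalars (R ⧸ I)).toLinearEquiv
  have hdim0 : Ring.KrullDimLE 0 (Localization.AtPrime qb) := by
    refine ⟨?_⟩
    have := hdimT.krullDim_le
    change ringKrullDim (Localization.AtPrime qb) ≤ _
    rw [show ringKrullDim (Localization.AtPrime qb) = ringKrullDim (Λq ⧸ J) from
      ringKrullDim_eq_of_ringEquiv e.toRingEquiv]
    exact this
  haveI : IsScalarTower k (Λ ⧸ IΛ) (Λq ⧸ J) :=
    IsScalarTower.of_algebraMap_eq fun x => by
      rw [IsScalarTower.algebraMap_apply k Λ (Λ ⧸ IΛ), Ideal.Quotient.algebraMap_eq, halgT,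
        ← IsScalarTower.algebraMap_apply k Λ Λq, IsScalarTower.algebraMap_apply k Λq (Λq ⧸ J),
        Ideal.Quotient.algebraMap_eq]
  ------------------------------------------------------------------
  -- the residue map `(Λ/IΛ)_{𝔮/IΛ} → κ(𝔮)` over `k`, with kernel `𝔪 · (Λ/IΛ)_{𝔮/IΛ}`
  ------------------------------------------------------------------
  let ρ₁ : (Λq ⧸ J) →ₐ[k] ResidueField Λq := Ideal.Quotient.factorₐ k hJle
  let ρ : Localization.AtPrime qb →ₐ[k] q.ResidueField := ρ₁.comp (e.restrictScalars k)
  have hρ₁ : Function.Surjective ρ₁ := fun y => by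
    obtain ⟨y, rfl⟩ := Ideal.Quotient.mk_surjective y
    exact ⟨Ideal.Quotient.mk J y, rfl⟩
  have hρ : Function.Surjective ρ := hρ₁.comp e.surjective
  have hker₁ : RingHom.ker ρ₁ = p.map (algebraMap R (Λq ⧸ J)) := by
    have : RingHom.ker ρ₁ = RingHom.ker (Ideal.Quotient.factor hJle) := rfl
    rw [this, ker_factor_eq_map, hmaxq, Ideal.map_map]
    rfl
  have hker : RingHom.ker ρ = 𝔪.map (algebraMap (R ⧸ I) (Localization.AtPrime qb)) := by
    have h1 : RingHom.ker ρ = (RingHom.ker ρ₁).comap (e : Localization.AtPrime qb →+* Λq ⧸ J) := by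
      ext x
      rw [RingHom.mem_ker, Ideal.mem_comap, RingHom.mem_ker]
      rfl
    have h2 : 𝔪.map (algebraMap (R ⧸ I) (Localization.AtPrime qb)) =
        p.map (algebraMap R (Localization.AtPrime qb)) := by
      rw [h𝔪, Ideal.map_map, ← Ideal.Quotient.algebraMap_eq, ← IsScalarTower.algebraMap_eq]
    rw [h1, hker₁, h2]
    -- `e` is an `R`-algebra isomorphism
    have h3 : (e : Localization.AtPrime qb →+* Λq ⧸ J).comp (algebraMap R (Localization.AtPrime qb)) =
        algebraMap R (Λq ⧸ J) := by
      rw [IsScalarTower.algebraMap_eq R (Λ ⧸ IΛ) (Localization.AtPrime qb), ← RingHom.comp_assoc,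
        IsScalarTower.algebraMap_eq R (Λ ⧸ IΛ) (Λq ⧸ J)]
      congr 1
      ext x
      exact e.commutes x
    rw [← h3, ← Ideal.map_map,
      Ideal.comap_map_of_bijective (e : Localization.AtPrime qb →+* Λq ⧸ J) e.bijective]
  ------------------------------------------------------------------
  -- conclude
  ------------------------------------------------------------------
  haveI : IsScalarTower k (R ⧸ I) (Λ ⧸ IΛ) := IsScalarTower.of_algebraMap_eq fun x => by
    change algebraMap k (Λ ⧸ IΛ) x = algebraMap (R ⧸ I) (Λ ⧸ IΛ) (algebraMap k (R ⧸ I) x)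
    rw [IsScalarTower.algebraMap_apply k R (R ⧸ I) x, Ideal.Quotient.algebraMap_eq,
      Ideal.Quotient.algebraMap_quotient_map_quotient, ← IsScalarTower.algebraMap_apply k R Λ x,
      IsScalarTower.algebraMap_apply k Λ (Λ ⧸ IΛ) x, Ideal.Quotient.algebraMap_eq]
  exact canResolve_of_flat_of_separable_residueField hsep 𝔪 h𝔪nil hk𝔪 ψ qb hq hdim0 ρ hρ hker

end ConcreteEndgame

end Literature.AlgebraicGeometry.Resolution

end
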